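import Summits.KontsevichZagierPeriods.KontsevichZagierPeriods.Theorems.K2SymbolChainsJensenIsScissorsDoublingAux
import Summits.KontsevichZagierPeriods.KontsevichZagierPeriods.Theorems.K2SymbolChainsJensenIsScissorsProduct
import Summits.KontsevichZagierPeriods.KontsevichZagierPeriods.Theorems.K2SymbolChainsJensenIsScissorsBaseLift

/-!
# Jensen is scissors — the doubling step, part A: `2 [L(ρ)] ~ [L(W_ρ · W_{−ρ})]`

Support file for item stmt-KontsevichZagierPeriods-5204 (`JensenIsScissors`, route
KontsevichZagierPeriods/K2SymbolChains). For a real centre function `ρ ≥ 0`, `ℚ`-semialgebraic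
and differentiable at the points of `B`, and an integrable `ℚ`-semialgebraic weight `h` on `B`, the
signed unfolding `L(ρ)` of `h(x)/(1 + s²) · log W_{ρ(x)}(s)` over `B × ℝ`
(`W_ρ(s) = ((1 − ρ)² + (1 + ρ)² s²)/(1 + s²) = |e^{iφ} − ρ|²`) satisfies, inside any subgroup `S`
containing the three scissors move sets, `2 [L(ρ)] − [L(W_ρ W_{−ρ})] ∈ S`, the second unfolding
being taken over the co-null base `{W_ρ ≠ 0}`: `[L(ρ)] ~ [L(−ρ)]` by the inversion `s ↦ −1/s`
(rule 2), off the null set `{s = 0}`), and `[L(ρ)] + [L(−ρ)] ~ [L(W_ρ W_{−ρ})]` by the signed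
product rule (file `Product`). [Kontsevich–Zagier 2001, §1.2, rules 1)–2)] [folklore]
-/

noncomputable section

open MeasureTheory Set
open Literature.NumberTheory.Transcendental Literature.ModelTheory.ExponentialFields

namespace Summit.KontsevichZagierPeriods.K2SymbolChains.JensenIsScissorsProof

open Literature.NumberTheory.Transcendental.KZ

variable {n : ℕ} {S : AddSubgroup FormalRep}

/-- **Doubling, part A**: `2 [L(ρ)] − [L(W_ρ · W_{−ρ})] ∈ S`. See the module docstring.
[Kontsevich–Zagier 2001, §1.2] [folklore] -/
theorem doubling_partA (hS : domainAddRel ∪ integrandAddRel ∪ changeOfVariablesRel ⊆ S)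
    {B : Set (Fin n → ℝ)} {h ρ : (Fin n → ℝ) → ℝ}
    (hB : IsSemialgebraic ℚ B) (hh : IsSemialgebraicFunOn ℚ B h) (hρs : IsSemialgebraicFunOn ℚ B ρ)
    (hρ0 : ∀ x ∈ B, 0 ≤ ρ x) (hρd : ∀ x ∈ B, DifferentiableAt ℝ ρ x) (hhi : IntegrableOn h B)
    (R : IntegralRep (n + 1 + 1))
    (hRd : R.domain = logUnfoldDomain {b : Fin (n + 1) → ℝ | Fin.init b ∈ B}
      (fun b => ((1 - ρ (Fin.init b)) ^ 2 + (1 + ρ (Fin.init b)) ^ 2 * b (Fin.last n) ^ 2) /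
        (1 + b (Fin.last n) ^ 2)))
    (hRi : EqOn R.integrand
      (logUnfoldIntegrand fun b => h (Fin.init b) / (1 + b (Fin.last n) ^ 2)) R.domain) :
    ∃ R₁₂ : IntegralRep (n + 1 + 1),
      R₁₂.domain = logUnfoldDomain {b : Fin (n + 1) → ℝ | Fin.init b ∈ B ∧
        ((1 - ρ (Fin.init b)) ^ 2 + (1 + ρ (Fin.init b)) ^ 2 * b (Fin.last n) ^ 2) /
          (1 + b (Fin.last n) ^ 2) ≠ 0}
        (fun b => ((1 - ρ (Fin.init b)) ^ 2 + (1 + ρ (Fin.init b)) ^ 2 * b (Fin.last n) ^ 2) /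
          (1 + b (Fin.last n) ^ 2) *
          (((1 + ρ (Fin.init b)) ^ 2 + (1 - ρ (Fin.init b)) ^ 2 * b (Fin.last n) ^ 2) /
            (1 + b (Fin.last n) ^ 2))) ∧
      R₁₂.integrand = logUnfoldIntegrand (fun b => h (Fin.init b) / (1 + b (Fin.last n) ^ 2)) ∧
      2 • of R - of R₁₂ ∈ S := by
  -- notation
  set T : Set (Fin (n + 1) → ℝ) := {b | Fin.init b ∈ B} with hT_def
  set G : (Fin (n + 1) → ℝ) → ℝ := fun b => h (Fin.init b) / (1 + b (Fin.last n) ^ 2) with hG_def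
  set Gh : (Fin (n + 1) → ℝ) → ℝ := fun b => (h (Fin.init b) / 2) / (1 + b (Fin.last n) ^ 2) with hGh_def
  set W : (Fin (n + 1) → ℝ) → ℝ := fun b =>
    ((1 - ρ (Fin.init b)) ^ 2 + (1 + ρ (Fin.init b)) ^ 2 * b (Fin.last n) ^ 2) / (1 + b (Fin.last n) ^ 2)
    with hW_def
  set Wm : (Fin (n + 1) → ℝ) → ℝ := fun b =>
    ((1 + ρ (Fin.init b)) ^ 2 + (1 - ρ (Fin.init b)) ^ 2 * b (Fin.last n) ^ 2) / (1 + b (Fin.last n) ^ 2)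
    with hWm_def
  set W₂ : (Fin (n + 1) → ℝ) → ℝ := fun b =>
    ((1 - ρ (Fin.init b) ^ 2) ^ 2 + (1 + ρ (Fin.init b) ^ 2) ^ 2 * b (Fin.last n) ^ 2) /
      (1 + b (Fin.last n) ^ 2) with hW₂_def
  -- semialgebraicity
  have hT : IsSemialgebraic ℚ T := isSemialgebraic_cyl hB
  have hGT : IsSemialgebraicFunOn ℚ T G := isSemialgebraicFunOn_weight hh hT subset_rfl
  have hh2 : IsSemialgebraicFunOn ℚ B (fun x => h x / 2) :=
    IsSemialgebraicFunOn.div hh (isSemialgebraicFunOn_ratCast hB 2 |>.congr fun _ _ => by simp) fun _ _ => by norm_num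
  have hGhT : IsSemialgebraicFunOn ℚ T Gh := isSemialgebraicFunOn_weight hh2 hT subset_rfl
  have hWT : IsSemialgebraicFunOn ℚ T W := isSemialgebraicFunOn_Wreal hρs hT subset_rfl
  have hWmT : IsSemialgebraicFunOn ℚ T Wm := by
    have := isSemialgebraicFunOn_Wreal (ρ := fun x => -ρ x) hρs.neg hT subset_rfl
    refine this.congr fun b _ => ?_
    simp only [hWm_def]
    ring
  have hρ2s : IsSemialgebraicFunOn ℚ B (fun x => ρ x ^ 2) :=
    (IsSemialgebraicFunOn.mul_holds hρs hρs).congr fun x _ => by simp [sq]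
  have hW₂T : IsSemialgebraicFunOn ℚ T W₂ := isSemialgebraicFunOn_Wreal hρ2s hT subset_rfl
  have hsT := isSemialgebraicFunOn_apply hT (Fin.last n)
  -- positivity
  have hW0 : ∀ b ∈ T, 0 ≤ W b := fun b _ => by simp only [hW_def]; positivity
  have hWm0 : ∀ b ∈ T, 0 < Wm b := fun b hb => by
    have h1 : 0 < 1 + ρ (Fin.init b) := by have := hρ0 _ hb; linarith
    simp only [hWm_def]
    positivity
  have hW₂0 : ∀ b ∈ T, 0 ≤ W₂ b := fun b _ => by simp only [hW₂_def]; positivity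
  have hWne : ∀ b ∈ T, b (Fin.last n) ≠ 0 → W b ≠ 0 := fun b hb hs => by
    have h1 : (1 + ρ (Fin.init b)) ≠ 0 := by have := hρ0 _ hb; positivity
    exact W_ne_zero_of_ne h1 hs
  have hW₂ne : ∀ b ∈ T, b (Fin.last n) ≠ 0 → W₂ b ≠ 0 := fun b hb hs => by
    have h1 : (1 + ρ (Fin.init b) ^ 2) ≠ 0 := by positivity
    exact W_ne_zero_of_ne h1 hs
  -- the good bases
  set T₀ : Set (Fin (n + 1) → ℝ) := {b | b ∈ T ∧ W b ≠ 0} with hT₀_def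
  set σ : Set (Fin (n + 1) → ℝ) := {b | b ∈ T ∧ b (Fin.last n) ≠ 0} with hσ_def
  set T₂ : Set (Fin (n + 1) → ℝ) := {b | b ∈ T ∧ W₂ b ≠ 0} with hT₂_def
  have hT₀s : IsSemialgebraic ℚ T₀ := hWT.isSemialgebraic_sep_ne_zero
  have hσs : IsSemialgebraic ℚ σ := hsT.isSemialgebraic_sep_ne_zero
  have hT₂s : IsSemialgebraic ℚ T₂ := hW₂T.isSemialgebraic_sep_ne_zero
  have hT₀T : T₀ ⊆ T := fun b hb => hb.1
  have hσT : σ ⊆ T := fun b hb => hb.1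
  have hT₂T : T₂ ⊆ T := fun b hb => hb.1
  have hσT₀ : σ ⊆ T₀ := fun b hb => ⟨hb.1, hWne b hb.1 hb.2⟩
  have hσT₂ : σ ⊆ T₂ := fun b hb => ⟨hb.1, hW₂ne b hb.1 hb.2⟩
  -- null sets: everything bad lies in `{s = 0} ∪ {s = 1} ∪ {s = -1}`
  have hnull0 : volume {b : Fin (n + 1) → ℝ | b (Fin.last n) = 0} = 0 := volume_setOf_last_eq_zero 0
  have hnull1 : volume {b : Fin (n + 1) → ℝ | b (Fin.last n) = 1} = 0 := volume_setOf_last_eq_zero 1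
  have hnullm1 : volume {b : Fin (n + 1) → ℝ | b (Fin.last n) = -1} = 0 := volume_setOf_last_eq_zero (-1)
  have hTT₀ : volume (T \ T₀) = 0 := measure_mono_null (fun b hb => by
    by_contra hs
    exact hb.2 ⟨hb.1, hWne b hb.1 hs⟩) hnull0
  have hT₀σ : volume (T₀ \ σ) = 0 := measure_mono_null (fun b hb => by
    by_contra hs
    exact hb.2 ⟨hb.1.1, hs⟩) hnull0
  have hTT₂ : volume (T \ T₂) = 0 := measure_mono_null (fun b hb => by
    by_contra hs
    exact hb.2 ⟨hb.1, hW₂ne b hb.1 hs⟩) hnull0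
  have hT₂σ : volume (T₂ \ σ) = 0 := measure_mono_null (fun b hb => by
    by_contra hs
    exact hb.2 ⟨hb.1.1, hs⟩) hnull0
  -- integrability of the weight on `T`
  have hGi : IntegrableOn G T := by
    have := integrableOn_cyl_mul (B := B) (f := h) (g := fun s : ℝ => (1 + s ^ 2)⁻¹) hhi integrable_inv_one_add_sq
    refine this.congr_fun (fun b _ => ?_) (IsSemialgebraic.measurableSet_holds hT)
    simp only [hG_def, div_eq_mul_inv]
  ----------------------------------------------------------------
  -- step 1: restrict `R` to `T₀`
  ----------------------------------------------------------------
  have s1 := of_sub_restrict_base_mem hS R hT₀s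
  set R₀ := R.restrict (R.domain ∩ {z | Fin.init z ∈ T₀})
    (R.isSemialgebraic_domain.inter (isSemialgebraic_cyl hT₀s)) inter_subset_left with hR₀
  set Rbad := R.restrict (R.domain \ {z | Fin.init z ∈ T₀})
    (R.isSemialgebraic_domain.diff (isSemialgebraic_cyl hT₀s)) sdiff_subset with hRbad
  have ebad : of Rbad ∈ S := by
    refine of_mem_of_base_null hS Rbad hTT₀ fun z hz => ?_
    rw [hRbad, IntegralRep.domain_restrict, hRd] at hz
    exact ⟨hz.1.1, hz.2⟩
  have hR₀d : R₀.domain = logUnfoldDomain T₀ W := by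
    rw [hR₀, IntegralRep.domain_restrict, hRd, logUnfoldDomain_inter_cyl, inter_eq_right.2 hT₀T]
  have hR₀i : EqOn R₀.integrand (logUnfoldIntegrand G) R₀.domain := fun z hz => hRi hz.1
  have e1 : of R - of R₀ ∈ S := by
    have : of R - of R₀ = (of R - of R₀ - of Rbad) + of Rbad := by abel
    rw [this]; exact S.add_mem s1 ebad
  ----------------------------------------------------------------
  -- step 2: the inversion `s ↦ -1/s` on `σ`, giving `L(−ρ)` over `T₀`
  ----------------------------------------------------------------
  have s2 := of_sub_restrict_base_mem hS R₀ hσs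
  set Rσ := R₀.restrict (R₀.domain ∩ {z | Fin.init z ∈ σ})
    (R₀.isSemialgebraic_domain.inter (isSemialgebraic_cyl hσs)) inter_subset_left with hRσ
  set Rσbad := R₀.restrict (R₀.domain \ {z | Fin.init z ∈ σ})
    (R₀.isSemialgebraic_domain.diff (isSemialgebraic_cyl hσs)) sdiff_subset with hRσbad
  have eσbad : of Rσbad ∈ S := by
    refine of_mem_of_base_null hS Rσbad hT₀σ fun z hz => ?_
    rw [hRσbad, IntegralRep.domain_restrict, hR₀d] at hz
    exact ⟨hz.1.1, hz.2⟩
  have hRσd : Rσ.domain = logUnfoldDomain σ W := by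
    rw [hRσ, IntegralRep.domain_restrict, hR₀d, logUnfoldDomain_inter_cyl, inter_eq_right.2 hσT₀]
  -- the inversion as rule-2) data on `σ`
  have hFs : IsSemialgebraicFunOn ℚ σ (fun b : Fin (n + 1) → ℝ => -(b (Fin.last n))⁻¹) :=
    ((hsT.mono hσT hσs).inv fun b hb => hb.2).neg
  have hFd : ∀ b ∈ σ, DifferentiableAt ℝ (fun b : Fin (n + 1) → ℝ => -(b (Fin.last n))⁻¹) b :=
    fun b hb => ((differentiableAt_apply (𝕜 := ℝ) (Fin.last n) b).inv hb.2).neg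
  have hFderiv : ∀ b ∈ σ, fderiv ℝ (fun b : Fin (n + 1) → ℝ => -(b (Fin.last n))⁻¹) b (Pi.single (Fin.last n) 1) =
      ((b (Fin.last n)) ^ 2)⁻¹ := fun b hb =>
    fderiv_apply_single_last (hFd b hb).hasFDerivAt (by simpa using hasDerivAt_neg_inv hb.2)
  obtain ⟨imap, ider, iinj⟩ := lastCoord_covData_basic (m := n) hσs hFs
    (F' := fun b => fderiv ℝ (fun b : Fin (n + 1) → ℝ => -(b (Fin.last n))⁻¹) b)
    (fun b hb => (hFd b hb).hasFDerivAt)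
    (fun b₁ _ b₂ _ hi hm => by
      have : b₁ (Fin.last n) = b₂ (Fin.last n) := by simpa using hm
      rw [← Fin.snoc_init_self b₁, ← Fin.snoc_init_self b₂, hi, this])
  have hinvσ : ∀ b ∈ σ, (Fin.snoc (Fin.init b) (-(b (Fin.last n))⁻¹) : Fin (n + 1) → ℝ) ∈ σ := fun b hb =>
    ⟨by simpa [hT_def] using hb.1, by simpa using hb.2⟩
  obtain ⟨Rm', hRm'd, hRm'i, s3⟩ := exists_image_baseLift hS imap ider iinj Rσ
    (by rw [hRσd]; exact fun z hz => hz.1) (D' := logUnfoldDomain σ Wm) (fun z hz => by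
      obtain ⟨hb, -⟩ := hz
      exact ⟨_, hinvσ _ hb, by simp⟩)
    (fun b hb u => by
      rw [hRσd, snoc_mem_logUnfoldDomain, snoc_mem_logUnfoldDomain]
      have hWW : W b = Wm (Fin.snoc (Fin.init b) (-(b (Fin.last n))⁻¹)) := by
        simp only [hW_def, hWm_def, Fin.init_snoc, Fin.snoc_last]
        exact (inv_W _ hb.2).symm
      rw [hWW]
      exact ⟨fun h => ⟨hinvσ b hb, h.2⟩, fun h => ⟨hb, h.2⟩⟩)
    (f' := logUnfoldIntegrand G)
    (isSemialgebraicFunOn_logUnfoldIntegrand (hGT.mono hσT hσs) (hWmT.mono hσT hσs)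
      fun b hb => (hWm0 b hb.1).le)
    (fun z hz => by
      have hb : Fin.init z ∈ σ := by rw [hRσd] at hz; exact hz.1
      have hzR : z ∈ R.domain := hz.1.1
      rw [hRσ, IntegralRep.integrand_restrict, hR₀, IntegralRep.integrand_restrict, hRi hzR,
        det_lastCoordDeriv, hFderiv _ hb, abs_of_pos (by have := hb.2; positivity),
        logUnfoldIntegrand, logUnfoldIntegrand]
      simp only [Fin.init_snoc, Fin.snoc_last, hG_def]
      rw [mul_div_assoc, mul_div_assoc, mul_assoc, div_mul_eq_mul_div, inv_weight _ hb.2])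
  -- extend `L(−ρ)` from `σ` to `T₀`
  obtain ⟨Rm, hRmd, hRmi, s4⟩ := exists_extend_null hS Rm' (D := logUnfoldDomain T₀ Wm)
    (isSemialgebraic_logUnfoldDomain (hWmT.mono hT₀T hT₀s))
    (by rw [hRm'd]; exact fun z hz => ⟨hσT₀ hz.1, hz.2⟩)
    (by
      rw [hRm'd]
      refine measure_mono_null (fun z hz => ?_) (volume_setOf_init_mem_eq_zero hT₀σ)
      obtain ⟨⟨hzT, hu⟩, hn⟩ := hz
      exact ⟨hzT, fun h => hn ⟨h, hu⟩⟩)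
    (f := logUnfoldIntegrand G)
    (isSemialgebraicFunOn_logUnfoldIntegrand (hGT.mono hT₀T hT₀s) (hWmT.mono hT₀T hT₀s)
      fun b hb => (hWm0 b hb.1).le)
    (by rw [hRm'i]; exact fun _ _ => rfl)
  have e2 : of R₀ - of Rm ∈ S := by
    have : of R₀ - of Rm = (of R₀ - of Rσ - of Rσbad) + of Rσbad + (of Rσ - of Rm') - (of Rm - of Rm') := by
      abel
    rw [this]
    exact S.sub_mem (S.add_mem (S.add_mem s2 eσbad) s3) s4
  ----------------------------------------------------------------
  -- step 3: the signed product rule on `T₀`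
  ----------------------------------------------------------------
  have hR₀int : IntegrableOn (logUnfoldIntegrand G) (logUnfoldDomain T₀ W) := by
    rw [← hR₀d]; exact R₀.integrableOn.congr_fun hR₀i (IntegralRep.measurableSet_domain_holds R₀)
  have hGlogW : IntegrableOn (fun b => G b * Real.log (W b)) T₀ :=
    integrableOn_mul_log_of_logUnfold hT₀s (hGT.mono hT₀T hT₀s) (hWT.mono hT₀T hT₀s)
      (fun b hb => (hW0 b hb.1).lt_of_ne (Ne.symm hb.2)) hR₀int
  have hRmint : IntegrableOn (logUnfoldIntegrand G) (logUnfoldDomain T₀ Wm) := by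
    rw [← hRmd, ← hRmi]; exact Rm.integrableOn
  have hGlogWm : IntegrableOn (fun b => G b * Real.log (Wm b)) T₀ :=
    integrableOn_mul_log_of_logUnfold hT₀s (hGT.mono hT₀T hT₀s) (hWmT.mono hT₀T hT₀s)
      (fun b hb => hWm0 b hb.1) hRmint
  have hprod_int : IntegrableOn (fun b => G b * Real.log (W b * Wm b)) T₀ := by
    refine (hGlogW.add hGlogWm).congr_fun (fun b hb => ?_) (IsSemialgebraic.measurableSet_holds hT₀s)
    rw [Real.log_mul hb.2 (hWm0 b hb.1).ne', Pi.add_apply]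
    ring
  set R₁₂ : IntegralRep (n + 1 + 1) := logUnfoldRep T₀ (fun b => W b * Wm b) G hT₀s (hGT.mono hT₀T hT₀s)
    (IsSemialgebraicFunOn.mul_holds (hWT.mono hT₀T hT₀s) (hWmT.mono hT₀T hT₀s))
    (fun b hb => mul_nonneg (hW0 b hb.1) (hWm0 b hb.1).le)
    (by
      rw [show {b | b ∈ T₀ ∧ W b * Wm b = 0} = (∅ : Set (Fin (n + 1) → ℝ)) by
        ext b; simp only [mem_setOf_eq, mem_empty_iff_false, iff_false, not_and]
        exact fun hb => mul_ne_zero hb.2 (hWm0 b hb.1).ne']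
      exact measure_empty)
    hprod_int with hR₁₂
  have e3 : of R₁₂ - of R₀ - of Rm ∈ S :=
    of_logUnfold_prod_sub_sub_mem hS hT₀s (hGT.mono hT₀T hT₀s) (hWT.mono hT₀T hT₀s) (hWmT.mono hT₀T hT₀s)
      (fun b hb => (hW0 b hb.1).lt_of_ne (Ne.symm hb.2)) (fun b hb => hWm0 b hb.1)
      (fun b hb => by
        have := differentiableAt_Wgen (n := n) (b := b) (hρd _ hb.1) 1 (-1) 1 1
        refine this.congr_of_eventuallyEq (Filter.Eventually.of_forall fun b => ?_)
        simp only [hW_def]; ring_nf)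
      (fun b hb => by
        have := differentiableAt_Wgen (n := n) (b := b) (hρd _ hb.1) 1 1 1 (-1)
        refine this.congr_of_eventuallyEq (Filter.Eventually.of_forall fun b => ?_)
        simp only [hWm_def]; ring_nf)
      (hGi.mono_set hT₀T) hGlogW hGlogWm R₁₂ R₀ Rm rfl (fun _ _ => rfl) hR₀d hR₀i hRmd
      (by rw [hRmi]; exact fun _ _ => rfl)
  refine ⟨R₁₂, rfl, rfl, ?_⟩
  have : 2 • of R - of R₁₂ = 2 • (of R - of R₀) - (of R₁₂ - of R₀ - of Rm) + (of R₀ - of Rm) := by abel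
  rw [this]
  exact S.add_mem (S.sub_mem (S.nsmul_mem e1 2) e3) e2

end Summit.KontsevichZagierPeriods.K2SymbolChains.JensenIsScissorsProof
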